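import Summits.HodgeConjecture.CorCM.Census.TwistGenerationNear

/-!
# Uniform twist generation, IV: THE COVERING FAMILY — one potential-lowering face per block, descent to the residual types,
# star reduction on the near classes

COR-CM (cell `pub-hodgecm2`), count-neutral kernel combinatorics by the binder seat b09 (gen 36; lane UNIFORM TWIST GENERATION, part IV), on
parts I–III (`Census/TwistGenerationDescent.lean`: `descent`, `single_sub_thetaG_mem_of`; `Census/TwistGenerationModel.lean`: `cst`, `ddist`, `pot`,
`nearCl`; `Census/TwistGenerationNear.lean`: the near-class calculus) used BY NAME.  Theorems only: no definition, no `decide`, no certificate,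
no named fact, no `sorry`.
HONEST FRAMING: `HC_CM` is NOT proved, here or anywhere in the tree; nothing here is a period or a headline.

**THE COVERING FAMILY** (`exists_cover`, along a datum `θ : G ≃ ℤ/2n × B`, `n ≥ 2`): a finite `S ⊆ gfaceSet` with at most one face relation per block
of potential `≥ 2` — at the block representative, toward a centre realising the potential, and toward THE NEAR CENTRE whenever the representative
lies in a near class (the UPPER rule at adjacent ties; §1 `exists_choice`) — such that for every submodule `L ⊇ ℤ⟨base changes of S⟩`:
* (a) `reduce_of_cover`: every vector is congruent modulo `L` to one supported on the residual types (potential `≤ 1`) — part I `descent` run on the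
  potential `pot`, the translated face at a type of potential `≥ 2` lowering the potential of its three other corners;
* (b) `star_of_cover`: for every centre `a` and every `Φ ∈ nearCl a`, `[Φ] − θ_{cst a}(typeSum [Φ]) ∈ L` — the STAR FORM about the near centre,
  part I `single_sub_thetaG_mem_of` run on the class `nearCl a`, which is base-change stable, has a unique index and is closed under deviation
  flips (part III), so that the translated block face is a face toward `a` with corners in the class.
No orientation or regime bookkeeping is needed: types outside the near classes are never evaluated.

## References
* [Pohlmann1968] H. Pohlmann, Algebraic cycles on abelian varieties of complex multiplication type, Ann. of Math. 88 (1968), Thm 1.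
* [Milne1999] J. S. Milne, Lefschetz motives and the Tate conjecture, Compositio Math. 117 (1999), Prop. 2.1, p. 54.
-/

namespace Summit.HodgeConjecture.CorCM.Census.TwistGeneration

open Finset
open Summit.HodgeConjecture.CorCM.Prior.AllgGroup.RfwfAllgGroup
open Summit.HodgeConjecture.CorCM.Census.BlockParity
open Summit.HodgeConjecture.CorCM.Census.Coinvariant

noncomputable section

variable {G : Type*} [Group G] [Fintype G] [DecidableEq G] {c : G}
variable {B : Type} [AddGroup B]
variable {n : ℕ} [NeZero n] (θ : G ≃ ZMod (2 * n) × B)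
variable (hθ : ∀ P Q : G, θ (P * Q) = θ P + θ Q) (hθc : θ c = (((n : ℕ) : ZMod (2 * n)), 0))

/-! ## §1 The choice at a block representative -/

/-- **The choice.**  At a type `r` of potential `≥ 2` there are a centre `a` realising the potential — equal to the near index whenever `r` lies
in a near class — and two distinct deviation places `t ≠ t'` of `cst a ∖ r`. [folklore] -/
theorem exists_choice (hn : 2 ≤ n) (r : CMF G c) (hr : 2 ≤ pot θ hθ hθc r) :
    ∃ a : ZMod (2 * n), ∃ t t' : G, pot θ hθ hθc r = ddist (cst θ hθ hθc a) r ∧ (∀ a'' : ZMod (2 * n), r ∈ nearCl θ hθ hθc a'' → a = a'') ∧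
      t ∈ (cst θ hθ hθc a).1 \ r.1 ∧ t' ∈ (cst θ hθ hθc a).1 \ r.1 ∧ t ≠ t' := by
  -- the centre: the near index if there is one, else any centre realising the potential
  have hcentre : ∃ a : ZMod (2 * n), pot θ hθ hθc r = ddist (cst θ hθ hθc a) r ∧
      ∀ a'' : ZMod (2 * n), r ∈ nearCl θ hθ hθc a'' → a = a'' := by
    by_cases h : ∃ a'', r ∈ nearCl θ hθ hθc a''
    · obtain ⟨a, ha⟩ := h
      exact ⟨a, pot_eq_of_near θ hθ hθc ha, fun a'' ha'' => near_unique θ hθ hθc hn ha ha''⟩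
    · obtain ⟨a, ha⟩ := exists_pot_eq θ hθ hθc r
      exact ⟨a, ha, fun a'' ha'' => absurd ⟨a'', ha''⟩ h⟩
  obtain ⟨a, ha, huniq⟩ := hcentre
  have h2 : 1 < ((cst θ hθ hθc a).1 \ r.1).card := by rw [ha, ddist] at hr; omega
  obtain ⟨t, ht, t', ht', htt'⟩ := Finset.one_lt_card.mp h2
  exact ⟨a, t, t', ha, huniq, ht, ht', htt'⟩

/-- Two distinct points of a CM type lie in distinct places. [folklore] -/
theorem not_mem_orb_of_mem {T : CMF G c} {t t' : G} (ht : t ∈ T.1) (ht' : t' ∈ T.1) (htt' : t ≠ t') : t' ∉ orb c t := by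
  rw [mem_orb]
  rintro (h | h)
  · exact htt' h.symm
  · exact ((T.2 t).mp ht) (h ▸ ht')

/-- Deviation places translate: `P ∈ (T·Q⁻¹) ∖ (Ψ·Q⁻¹) ↔ PQ ∈ T ∖ Ψ`. [folklore] -/
theorem mem_sdiff_rt_iff (Q : G) (T Ψ : CMF G c) (P : G) : P ∈ (rt c Q T).1 \ (rt c Q Ψ).1 ↔ P * Q ∈ T.1 \ Ψ.1 := by
  rw [mem_sdiff, mem_sdiff, mem_rt, mem_rt]

/-! ## §2 The covering family -/

/-- **THE COVERING FAMILY.**  Along a datum with `n ≥ 2`: a finite `S ⊆ gfaceSet` with at most one member per block of potential `≥ 2` such that,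
for every submodule `L ⊇ ℤ⟨base changes of S⟩`, (a) every vector is congruent modulo `L` to one supported on types of potential `≤ 1`, and
(b) `[Φ] − θ_{cst a}(typeSum [Φ]) ∈ L` for every centre `a` and every `Φ ∈ nearCl a`. [folklore] -/
theorem exists_cover (hc2 : c * c = 1) (hn : 2 ≤ n) :
    ∃ S : Finset (CMF G c →₀ ℤ), (↑S ⊆ gfaceSet G c hc2) ∧
      S.card ≤ (univ.filter fun Bk : Block c => 2 ≤ pot θ hθ hθc Bk.out).card ∧
      ∀ L : Submodule ℤ (CMF G c →₀ ℤ), Submodule.span ℤ (translates c S) ≤ L →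
        (∀ y : CMF G c →₀ ℤ, ∃ y' : CMF G c →₀ ℤ, y - y' ∈ L ∧ ∀ Ψ ∈ y'.support, pot θ hθ hθc Ψ ≤ 1) ∧
        (∀ (a : ZMod (2 * n)) (Φ : CMF G c), Φ ∈ nearCl θ hθ hθc a →
          Finsupp.single Φ 1 - thetaG c hc2 (cst θ hθ hθc a) (typeSum G c (Finsupp.single Φ 1)) ∈ L) := by
  classical
  -- the choice at every block representative of potential `≥ 2`
  have hch : ∀ Bk : Block c, ∃ τ : ZMod (2 * n) × G × G, 2 ≤ pot θ hθ hθc Bk.out →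
      pot θ hθ hθc Bk.out = ddist (cst θ hθ hθc τ.1) Bk.out ∧ (∀ a'' : ZMod (2 * n), Bk.out ∈ nearCl θ hθ hθc a'' → τ.1 = a'') ∧
        τ.2.1 ∈ (cst θ hθ hθc τ.1).1 \ Bk.out.1 ∧ τ.2.2 ∈ (cst θ hθ hθc τ.1).1 \ Bk.out.1 ∧ τ.2.1 ≠ τ.2.2 := by
    intro Bk
    by_cases h : 2 ≤ pot θ hθ hθc Bk.out
    · obtain ⟨a, t, t', h1, h2, h3, h4, h5⟩ := exists_choice θ hθ hθc hn Bk.out h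
      exact ⟨(a, t, t'), fun _ => ⟨h1, h2, h3, h4, h5⟩⟩
    · exact ⟨(0, 1, 1), fun h' => absurd h' h⟩
  choose τ hτ using hch
  set NI : Finset (Block c) := univ.filter fun Bk : Block c => 2 ≤ pot θ hθ hθc Bk.out with hNI
  set S : Finset (CMF G c →₀ ℤ) := NI.image fun Bk => gface c hc2 Bk.out (τ Bk).2.1 (τ Bk).2.2 with hS
  have hSsub : (↑S : Set (CMF G c →₀ ℤ)) ⊆ gfaceSet G c hc2 := by
    intro y hy
    obtain ⟨Bk, hBk, rfl⟩ := mem_image.mp (mem_coe.mp hy)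
    obtain ⟨-, -, h3, h4, h5⟩ := hτ Bk (mem_filter.mp hBk).2
    exact ⟨Bk.out, _, _, not_mem_orb_of_mem (mem_sdiff.mp h3).1 (mem_sdiff.mp h4).1 h5, rfl⟩
  refine ⟨S, hSsub, card_image_le, fun L hL => ?_⟩
  -- the translated block face through an arbitrary type of potential `≥ 2`
  have hface : ∀ Ψ : CMF G c, 2 ≤ pot θ hθ hθc Ψ → ∃ Q : G, rt c Q (blk c Ψ).out = Ψ ∧ (blk c Ψ) ∈ NI ∧
      gface c hc2 Ψ ((τ (blk c Ψ)).2.1 * Q⁻¹) ((τ (blk c Ψ)).2.2 * Q⁻¹) ∈ L := by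
    intro Ψ hΨ
    obtain ⟨Q, hQ⟩ := exists_rt_eq_of_blk_eq c (Quotient.out_eq (blk c Ψ) : blk c (blk c Ψ).out = blk c Ψ)
    have hpot : pot θ hθ hθc (blk c Ψ).out = pot θ hθ hθc Ψ := by
      have h := pot_rt θ hθ hθc Q (blk c Ψ).out
      rw [hQ] at h; exact h.symm
    have hBNI : blk c Ψ ∈ NI := mem_filter.mpr ⟨mem_univ _, by rw [hpot]; exact hΨ⟩
    refine ⟨Q, hQ, hBNI, ?_⟩
    have e : gface c hc2 Ψ ((τ (blk c Ψ)).2.1 * Q⁻¹) ((τ (blk c Ψ)).2.2 * Q⁻¹) =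
        Finsupp.mapDomain (rt c Q) (gface c hc2 (blk c Ψ).out (τ (blk c Ψ)).2.1 (τ (blk c Ψ)).2.2) := by
      rw [mapDomain_rt_gface, hQ]
    rw [e]
    exact hL (Submodule.subset_span ⟨Q, _, mem_image_of_mem _ hBNI, rfl⟩)
  refine ⟨fun y => ?_, fun a => ?_⟩
  · -- (a) descent on the potential
    refine descent c (pot θ hθ hθc) (fun Ψ => pot θ hθ hθc Ψ ≤ 1) hc2 L (fun Ψ hΨ => ?_) y
    have hΨ2 : 2 ≤ pot θ hθ hθc Ψ := by omega
    obtain ⟨Q, hQ, hBNI, hmem⟩ := hface Ψ hΨ2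
    obtain ⟨h1, -, h3, h4, h5⟩ := hτ (blk c Ψ) (mem_filter.mp hBNI).2
    set a := (τ (blk c Ψ)).1
    set t := (τ (blk c Ψ)).2.1
    set t' := (τ (blk c Ψ)).2.2
    -- deviation places of `Ψ` from the translated centre
    have hpotΨ : pot θ hθ hθc Ψ = ddist (cst θ hθ hθc (a - (θ Q).1)) Ψ := by
      rw [← hQ, pot_rt, ← rt_cst θ hθ hθc, ddist_rt]; exact h1
    have hs : t * Q⁻¹ ∈ (cst θ hθ hθc (a - (θ Q).1)).1 \ Ψ.1 := by
      rw [← rt_cst θ hθ hθc, ← hQ, mem_sdiff_rt_iff, inv_mul_cancel_right]; exact h3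
    have hs' : t' * Q⁻¹ ∈ (cst θ hθ hθc (a - (θ Q).1)).1 \ Ψ.1 := by
      rw [← rt_cst θ hθ hθc, ← hQ, mem_sdiff_rt_iff, inv_mul_cancel_right]; exact h4
    have hss' : t * Q⁻¹ ≠ t' * Q⁻¹ := fun h => h5 (mul_right_cancel h)
    have hs'' : t * Q⁻¹ ∈ (cst θ hθ hθc (a - (θ Q).1)).1 \ (oflipCM c hc2 (t' * Q⁻¹) Ψ).1 := by
      rw [dev_oflip c hc2 (mem_sdiff.mp hs').1 (mem_sdiff.mp hs').2]; exact mem_erase.mpr ⟨hss', hs⟩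
    have d1 := ddist_oflipCM_of_mem_sdiff hc2 hs
    have d2 := ddist_oflipCM_of_mem_sdiff hc2 hs'
    have d3 := ddist_oflipCM_of_mem_sdiff hc2 hs''
    refine ⟨t * Q⁻¹, t' * Q⁻¹, hmem, ?_, ?_, ?_⟩
    · have := pot_le θ hθ hθc (oflipCM c hc2 (t * Q⁻¹) Ψ) (a - (θ Q).1); omega
    · have := pot_le θ hθ hθc (oflipCM c hc2 (t' * Q⁻¹) Ψ) (a - (θ Q).1); omega
    · have := pot_le θ hθ hθc (oflipCM c hc2 (t * Q⁻¹) (oflipCM c hc2 (t' * Q⁻¹) Ψ)) (a - (θ Q).1); omega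
  · -- (b) star reduction on the near class of `a`
    refine single_sub_thetaG_mem_of c (cst θ hθ hθc a) (fun Φ => Φ ∈ nearCl θ hθ hθc a) hc2 L (fun Φ hΦ hdev => ?_)
    have hΦ2 : 2 ≤ pot θ hθ hθc Φ := by rw [pot_eq_of_near θ hθ hθc hΦ, ddist]; exact hdev
    obtain ⟨Q, hQ, hBNI, hmem⟩ := hface Φ hΦ2
    obtain ⟨-, h2, h3, h4, h5⟩ := hτ (blk c Φ) (mem_filter.mp hBNI).2
    -- the representative lies in the near class of `a + (θQ).1`, so the choice was made toward it
    have hout : (blk c Φ).out ∈ nearCl θ hθ hθc (a - (θ Q⁻¹).1) := by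
      rw [← rt_inv_rt c Q (blk c Φ).out, hQ]; exact near_rt θ hθ hθc hΦ Q⁻¹
    have ha : (τ (blk c Φ)).1 = a - (θ Q⁻¹).1 := h2 _ hout
    have hcst : rt c Q (cst θ hθ hθc (τ (blk c Φ)).1) = cst θ hθ hθc a := by
      rw [rt_cst, ha, map_inv_eq θ hθ, Prod.fst_neg]; ring_nf
    set t := (τ (blk c Φ)).2.1
    set t' := (τ (blk c Φ)).2.2
    have hs : t * Q⁻¹ ∈ (cst θ hθ hθc a).1 \ Φ.1 := by
      have h := (mem_sdiff_rt_iff Q (cst θ hθ hθc (τ (blk c Φ)).1) (blk c Φ).out (t * Q⁻¹)).mpr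
        (by rw [inv_mul_cancel_right]; exact h3)
      rwa [hcst, hQ] at h
    have hs' : t' * Q⁻¹ ∈ (cst θ hθ hθc a).1 \ Φ.1 := by
      have h := (mem_sdiff_rt_iff Q (cst θ hθ hθc (τ (blk c Φ)).1) (blk c Φ).out (t' * Q⁻¹)).mpr
        (by rw [inv_mul_cancel_right]; exact h4)
      rwa [hcst, hQ] at h
    have hss' : t * Q⁻¹ ≠ t' * Q⁻¹ := fun h => h5 (mul_right_cancel h)
    exact ⟨t * Q⁻¹, t' * Q⁻¹, hs, hs', hss', hmem, near_oflipCM θ hθ hθc hc2 hΦ hs, near_oflipCM θ hθ hθc hc2 hΦ hs',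
      near_oflipCM_oflipCM θ hθ hθc hc2 hΦ hs hs' hss'⟩

end

end Summit.HodgeConjecture.CorCM.Census.TwistGeneration
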